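import Summits.KontsevichZagierPeriods.KontsevichZagierPeriods.Theorems.RootDecompZetaThreeFrontierGZLadderFourPolarP02

/-! # `RootDecompZetaThreeFrontierGZLadderFourPolarP03` — part 3/12 of the mechanical ≤400-line split of `l4_src.lean` (sha256 5cc5a9ee4c47da9a…)
Source: decomp-kz lens-1 g13 Layer4_v1.lean @897236f9 minus the RungFour prelude block (imported from …RungFourPreludeP14); --supports stmt-KontsevichZagierPeriods-27141.
Split by census-1 g10 `gen/splitlean.py`: scopes re-opened with their `open`/`variable`/`set_option` context; mathematics and declaration order unchanged. -/

set_option linter.dupNamespace false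
noncomputable section
set_option linter.dupNamespace false
set_option linter.unusedVariables false
set_option linter.unusedSectionVars false
set_option linter.unusedSimpArgs false
open Set MeasureTheory MvPolynomial
open Literature.NumberTheory.Transcendental
open Summit.KontsevichZagierPeriods.KontsevichZagierPeriods.Theorems.RootDecompZetaThreeFrontierWordMoves
open Summit.KontsevichZagierPeriods.KontsevichZagierPeriods.Cruxes.GZNormalFormWThree.GZLadder.RungThree (congInto_mono congInto_of_mem_closure congInto_of_sub_mem)

namespace Summit.KontsevichZagierPeriods.KontsevichZagierPeriods.Cruxes.GZNormalFormWThree.GZLadder.WlogFour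

/-- **face 4** (`a₀₁`): integrability forces the factor with exponent `a₀₁` to cancel (via `s03`) -/
theorem face4_4 (p : MvPolynomial (Fin 4) ℚ) (b₀ b₁ b₂ c₀ c₁ c₂ c₃ a₀₁ a₀₂ a₀₃ a₁₃ : ℕ)
    (hint : IntegrableOn (gzf4 p b₀ b₁ b₂ 0 c₀ c₁ c₂ c₃ a₀₁ a₀₂ a₀₃ 0 a₁₃ 0) (KZ.openOrderedSimplex 4)) :
    ∃ p' : MvPolynomial (Fin 4) ℚ, EqOn (gzf4 p b₀ b₁ b₂ 0 c₀ c₁ c₂ c₃ a₀₁ a₀₂ a₀₃ 0 a₁₃ 0) (gzf4 p' b₀ b₁ b₂ 0 c₀ c₁ c₂ c₃ 0 a₀₂ a₀₃ 0 a₁₃ 0) (KZ.openOrderedSimplex 4) := by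
  have hsupp : ∀ e ∈ (s03P p).support, a₀₁ ≤ e 3 := by
    refine face_lemma4 (measurableSet_simplex 4) (fun y hy => (gz4_denoms_pos hy).2.2.2.1.ne')
      (KZ.isOpen_openOrderedSimplex 3) simplex_three_nonempty (fun x => x 2) (fun x hx => snoc_section_four hx)
      (fun x hx => section_base hx)
      (fun u => u 0 ^ b₀ * (u 0 - u 3) ^ b₁ * (u 0 - u 2) ^ b₂ * (1 - u 0) ^ c₀ * (1 - (u 0 - u 3)) ^ c₁ * (1 - (u 0 - u 2)) ^ c₂ * (1 - (u 0 - u 1)) ^ c₃ * (u 0 - (u 0 - u 2)) ^ a₀₂ * (u 0 - (u 0 - u 1)) ^ a₀₃ * ((u 0 - u 3) - (u 0 - u 1)) ^ a₁₃)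
      (fun x _ => ?_) (fun x hx => ?_) a₀₁ (s03P p)
      ((integrableOn_comp_s03 hint).congr_fun (fun u hu => ?_) (measurableSet_simplex 4))
    · show ContinuousAt (fun s : ℝ => x 0 ^ b₀ * (x 0 - s) ^ b₁ * (x 0 - x 2) ^ b₂ * (1 - x 0) ^ c₀ * (1 - (x 0 - s)) ^ c₁ * (1 - (x 0 - x 2)) ^ c₂ * (1 - (x 0 - x 1)) ^ c₃ * (x 0 - (x 0 - x 2)) ^ a₀₂ * (x 0 - (x 0 - x 1)) ^ a₀₃ * ((x 0 - s) - (x 0 - x 1)) ^ a₁₃) 0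
      exact (by fun_prop : Continuous fun s : ℝ => x 0 ^ b₀ * (x 0 - s) ^ b₁ * (x 0 - x 2) ^ b₂ * (1 - x 0) ^ c₀ * (1 - (x 0 - s)) ^ c₁ * (1 - (x 0 - x 2)) ^ c₂ * (1 - (x 0 - x 1)) ^ c₃ * (x 0 - (x 0 - x 2)) ^ a₀₂ * (x 0 - (x 0 - x 1)) ^ a₀₃ * ((x 0 - s) - (x 0 - x 1)) ^ a₁₃).continuousAt
    · obtain ⟨f0, f1, f2, f3, f4, f5, f6, f7, f8⟩ := gz3_denoms_pos hx
      show x 0 ^ b₀ * (x 0 - (0:ℝ)) ^ b₁ * (x 0 - x 2) ^ b₂ * (1 - x 0) ^ c₀ * (1 - (x 0 - (0:ℝ))) ^ c₁ * (1 - (x 0 - x 2)) ^ c₂ * (1 - (x 0 - x 1)) ^ c₃ * (x 0 - (x 0 - x 2)) ^ a₀₂ * (x 0 - (x 0 - x 1)) ^ a₀₃ * ((x 0 - (0:ℝ)) - (x 0 - x 1)) ^ a₁₃ ≠ 0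
      have : (0:ℝ) < (x 0 - (0:ℝ)) := by linarith
      have : (0:ℝ) < (x 0 - x 2) := by linarith
      have : (0:ℝ) < (1 - x 0) := by linarith
      have : (0:ℝ) < (1 - (x 0 - (0:ℝ))) := by linarith
      have : (0:ℝ) < (1 - (x 0 - x 2)) := by linarith
      have : (0:ℝ) < (1 - (x 0 - x 1)) := by linarith
      have : (0:ℝ) < (x 0 - (x 0 - x 2)) := by linarith
      have : (0:ℝ) < (x 0 - (x 0 - x 1)) := by linarith
      have : (0:ℝ) < ((x 0 - (0:ℝ)) - (x 0 - x 1)) := by linarith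
      positivity
    · obtain ⟨g0, g1, g2, g3, g4, g5, g6, g7, g8, g9, g10, g11, g12, g13⟩ := gz4_denoms_pos hu
      have : (0:ℝ) < (u 0 - u 3) := by linarith
      have : (0:ℝ) < (u 0 - u 2) := by linarith
      have : (0:ℝ) < (1 - u 0) := by linarith
      have : (0:ℝ) < (1 - (u 0 - u 3)) := by linarith
      have : (0:ℝ) < (1 - (u 0 - u 2)) := by linarith
      have : (0:ℝ) < (1 - (u 0 - u 1)) := by linarith
      have : (0:ℝ) < (u 0 - (u 0 - u 2)) := by linarith
      have : (0:ℝ) < (u 0 - (u 0 - u 1)) := by linarith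
      have : (0:ℝ) < ((u 0 - u 3) - (u 0 - u 1)) := by linarith
      have : (0:ℝ) < (u 0 - (u 0 - u 3)) := by linarith
      show gzf4 p b₀ b₁ b₂ 0 c₀ c₁ c₂ c₃ a₀₁ a₀₂ a₀₃ 0 a₁₃ 0 (s03 u) = MvPolynomial.aeval u (s03P p) / (u 3 ^ a₀₁ * (u 0 ^ b₀ * (u 0 - u 3) ^ b₁ * (u 0 - u 2) ^ b₂ * (1 - u 0) ^ c₀ * (1 - (u 0 - u 3)) ^ c₁ * (1 - (u 0 - u 2)) ^ c₂ * (1 - (u 0 - u 1)) ^ c₃ * (u 0 - (u 0 - u 2)) ^ a₀₂ * (u 0 - (u 0 - u 1)) ^ a₀₃ * ((u 0 - u 3) - (u 0 - u 1)) ^ a₁₃))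
      rw [aeval_s03P]
      simp only [gzf4, s03_zero, s03_one, s03_two, s03_three, pow_zero, mul_one, one_mul]
      rw [div_eq_div_iff (by positivity) (by positivity)]
      ring
  obtain ⟨q, hq⟩ := exists_X_pow_mul_fin 3 a₀₁ (s03P p) hsupp
  have hp : p = (MvPolynomial.X 0 - MvPolynomial.X 1) ^ a₀₁ * s03P q := by
    rw [← s03P_s03P p, hq, map_mul, map_pow]
    congr 2
    simp [s03P, MvPolynomial.bind₁_X_right, sub_sub_cancel]
  refine ⟨s03P q, fun t ht => ?_⟩
  obtain ⟨g0, g1, g2, g3, g4, g5, g6, g7, g8, g9, g10, g11, g12, g13⟩ := gz4_denoms_pos ht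
  rw [hp]
  simp only [gzf4, map_mul, map_pow, map_sub, MvPolynomial.aeval_X, MvPolynomial.aeval_C, map_one, pow_zero, mul_one, one_mul]
  rw [div_eq_div_iff (by positivity) (by positivity)]
  ring

/-- **face 5** (`c₀`): integrability forces the factor with exponent `c₀` to cancel (via `du4`) -/
theorem face4_5 (p : MvPolynomial (Fin 4) ℚ) (b₀ b₁ b₂ c₀ c₁ c₂ c₃ a₀₂ a₀₃ a₁₃ : ℕ)
    (hint : IntegrableOn (gzf4 p b₀ b₁ b₂ 0 c₀ c₁ c₂ c₃ 0 a₀₂ a₀₃ 0 a₁₃ 0) (KZ.openOrderedSimplex 4)) :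
    ∃ p' : MvPolynomial (Fin 4) ℚ, EqOn (gzf4 p b₀ b₁ b₂ 0 c₀ c₁ c₂ c₃ 0 a₀₂ a₀₃ 0 a₁₃ 0) (gzf4 p' b₀ b₁ b₂ 0 0 c₁ c₂ c₃ 0 a₀₂ a₀₃ 0 a₁₃ 0) (KZ.openOrderedSimplex 4) := by
  have hsupp : ∀ e ∈ (du4P p).support, c₀ ≤ e 3 := by
    refine face_lemma4 (measurableSet_simplex 4) (fun y hy => (gz4_denoms_pos hy).2.2.2.1.ne')
      (KZ.isOpen_openOrderedSimplex 3) simplex_three_nonempty (fun x => x 2) (fun x hx => snoc_section_four hx)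
      (fun x hx => section_base hx)
      (fun u => (1 - u 3) ^ b₀ * (1 - u 2) ^ b₁ * (1 - u 1) ^ b₂ * (1 - (1 - u 2)) ^ c₁ * (1 - (1 - u 1)) ^ c₂ * (1 - (1 - u 0)) ^ c₃ * ((1 - u 3) - (1 - u 1)) ^ a₀₂ * ((1 - u 3) - (1 - u 0)) ^ a₀₃ * ((1 - u 2) - (1 - u 0)) ^ a₁₃)
      (fun x _ => ?_) (fun x hx => ?_) c₀ (du4P p)
      ((integrableOn_comp_du4 hint).congr_fun (fun u hu => ?_) (measurableSet_simplex 4))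
    · show ContinuousAt (fun s : ℝ => (1 - s) ^ b₀ * (1 - x 2) ^ b₁ * (1 - x 1) ^ b₂ * (1 - (1 - x 2)) ^ c₁ * (1 - (1 - x 1)) ^ c₂ * (1 - (1 - x 0)) ^ c₃ * ((1 - s) - (1 - x 1)) ^ a₀₂ * ((1 - s) - (1 - x 0)) ^ a₀₃ * ((1 - x 2) - (1 - x 0)) ^ a₁₃) 0
      exact (by fun_prop : Continuous fun s : ℝ => (1 - s) ^ b₀ * (1 - x 2) ^ b₁ * (1 - x 1) ^ b₂ * (1 - (1 - x 2)) ^ c₁ * (1 - (1 - x 1)) ^ c₂ * (1 - (1 - x 0)) ^ c₃ * ((1 - s) - (1 - x 1)) ^ a₀₂ * ((1 - s) - (1 - x 0)) ^ a₀₃ * ((1 - x 2) - (1 - x 0)) ^ a₁₃).continuousAt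
    · obtain ⟨f0, f1, f2, f3, f4, f5, f6, f7, f8⟩ := gz3_denoms_pos hx
      show (1 - (0:ℝ)) ^ b₀ * (1 - x 2) ^ b₁ * (1 - x 1) ^ b₂ * (1 - (1 - x 2)) ^ c₁ * (1 - (1 - x 1)) ^ c₂ * (1 - (1 - x 0)) ^ c₃ * ((1 - (0:ℝ)) - (1 - x 1)) ^ a₀₂ * ((1 - (0:ℝ)) - (1 - x 0)) ^ a₀₃ * ((1 - x 2) - (1 - x 0)) ^ a₁₃ ≠ 0
      have : (0:ℝ) < (1 - (0:ℝ)) := by linarith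
      have : (0:ℝ) < (1 - x 2) := by linarith
      have : (0:ℝ) < (1 - x 1) := by linarith
      have : (0:ℝ) < (1 - (1 - x 2)) := by linarith
      have : (0:ℝ) < (1 - (1 - x 1)) := by linarith
      have : (0:ℝ) < (1 - (1 - x 0)) := by linarith
      have : (0:ℝ) < ((1 - (0:ℝ)) - (1 - x 1)) := by linarith
      have : (0:ℝ) < ((1 - (0:ℝ)) - (1 - x 0)) := by linarith
      have : (0:ℝ) < ((1 - x 2) - (1 - x 0)) := by linarith
      positivity
    · obtain ⟨g0, g1, g2, g3, g4, g5, g6, g7, g8, g9, g10, g11, g12, g13⟩ := gz4_denoms_pos hu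
      have : (0:ℝ) < (1 - u 3) := by linarith
      have : (0:ℝ) < (1 - u 2) := by linarith
      have : (0:ℝ) < (1 - u 1) := by linarith
      have : (0:ℝ) < (1 - (1 - u 2)) := by linarith
      have : (0:ℝ) < (1 - (1 - u 1)) := by linarith
      have : (0:ℝ) < (1 - (1 - u 0)) := by linarith
      have : (0:ℝ) < ((1 - u 3) - (1 - u 1)) := by linarith
      have : (0:ℝ) < ((1 - u 3) - (1 - u 0)) := by linarith
      have : (0:ℝ) < ((1 - u 2) - (1 - u 0)) := by linarith
      have : (0:ℝ) < (1 - (1 - u 3)) := by linarith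
      show gzf4 p b₀ b₁ b₂ 0 c₀ c₁ c₂ c₃ 0 a₀₂ a₀₃ 0 a₁₃ 0 (du4 u) = MvPolynomial.aeval u (du4P p) / (u 3 ^ c₀ * ((1 - u 3) ^ b₀ * (1 - u 2) ^ b₁ * (1 - u 1) ^ b₂ * (1 - (1 - u 2)) ^ c₁ * (1 - (1 - u 1)) ^ c₂ * (1 - (1 - u 0)) ^ c₃ * ((1 - u 3) - (1 - u 1)) ^ a₀₂ * ((1 - u 3) - (1 - u 0)) ^ a₀₃ * ((1 - u 2) - (1 - u 0)) ^ a₁₃))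
      rw [aeval_du4P]
      simp only [gzf4, du4_zero, du4_one, du4_two, du4_three, pow_zero, mul_one, one_mul]
      rw [div_eq_div_iff (by positivity) (by positivity)]
      ring
  obtain ⟨q, hq⟩ := exists_X_pow_mul_fin 3 c₀ (du4P p) hsupp
  have hp : p = (MvPolynomial.C 1 - MvPolynomial.X 0) ^ c₀ * du4P q := by
    rw [← du4P_du4P p, hq, map_mul, map_pow]
    congr 2
    simp [du4P, MvPolynomial.bind₁_X_right, sub_sub_cancel]
  refine ⟨du4P q, fun t ht => ?_⟩
  obtain ⟨g0, g1, g2, g3, g4, g5, g6, g7, g8, g9, g10, g11, g12, g13⟩ := gz4_denoms_pos ht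
  rw [hp]
  simp only [gzf4, map_mul, map_pow, map_sub, MvPolynomial.aeval_X, MvPolynomial.aeval_C, map_one, pow_zero, mul_one, one_mul]
  rw [div_eq_div_iff (by positivity) (by positivity)]
  ring

/-- **the five faces cancel**: an integrable genus-zero integrand on `Δ₄` is a REDUCED form (poles on the nine non-adjacent chords only) -/
theorem faces4_cancel (p : MvPolynomial (Fin 4) ℚ) (b₀ b₁ b₂ b₃ c₀ c₁ c₂ c₃ a₀₁ a₀₂ a₀₃ a₁₂ a₁₃ a₂₃ : ℕ)
    (hint : IntegrableOn (gzf4 p b₀ b₁ b₂ b₃ c₀ c₁ c₂ c₃ a₀₁ a₀₂ a₀₃ a₁₂ a₁₃ a₂₃) (KZ.openOrderedSimplex 4)) :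
    ∃ p' : MvPolynomial (Fin 4) ℚ, EqOn (gzf4 p b₀ b₁ b₂ b₃ c₀ c₁ c₂ c₃ a₀₁ a₀₂ a₀₃ a₁₂ a₁₃ a₂₃)
      (fun t => MvPolynomial.aeval t p' / (t 0 ^ b₀ * t 1 ^ b₁ * t 2 ^ b₂ * (1 - t 1) ^ c₁ * (1 - t 2) ^ c₂ * (1 - t 3) ^ c₃ * (t 0 - t 2) ^ a₀₂ * (t 0 - t 3) ^ a₀₃ * (t 1 - t 3) ^ a₁₃))
      (KZ.openOrderedSimplex 4) := by
  obtain ⟨p1, h1⟩ := face4_1 p b₀ b₁ b₂ b₃ c₀ c₁ c₂ c₃ a₀₁ a₀₂ a₀₃ a₁₂ a₁₃ a₂₃ hint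
  have hint1 := hint.congr_fun h1 (measurableSet_simplex 4)
  obtain ⟨p2, h2⟩ := face4_2 p1 b₀ b₁ b₂ c₀ c₁ c₂ c₃ a₀₁ a₀₂ a₀₃ a₁₂ a₁₃ a₂₃ hint1
  have hint2 := hint1.congr_fun h2 (measurableSet_simplex 4)
  obtain ⟨p3, h3⟩ := face4_3 p2 b₀ b₁ b₂ c₀ c₁ c₂ c₃ a₀₁ a₀₂ a₀₃ a₁₂ a₁₃ hint2
  have hint3 := hint2.congr_fun h3 (measurableSet_simplex 4)
  obtain ⟨p4, h4⟩ := face4_4 p3 b₀ b₁ b₂ c₀ c₁ c₂ c₃ a₀₁ a₀₂ a₀₃ a₁₃ hint3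
  have hint4 := hint3.congr_fun h4 (measurableSet_simplex 4)
  obtain ⟨p5, h5⟩ := face4_5 p4 b₀ b₁ b₂ c₀ c₁ c₂ c₃ a₀₂ a₀₃ a₁₃ hint4
  have hint5 := hint4.congr_fun h5 (measurableSet_simplex 4)
  refine ⟨p5, fun t ht => ?_⟩
  rw [h1 ht, h2 ht, h3 ht, h4 ht, h5 ht]
  simp only [gzf4, pow_zero, mul_one, one_mul]

/-- the `IsGZ 4` hypothesis shape is `gzf4` -/
theorem gzForm_four (p : MvPolynomial (Fin 4) ℚ) (a : Fin 4 → Fin 4 → ℕ) (b c : Fin 4 → ℕ) (t : Fin 4 → ℝ) :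
    MvPolynomial.aeval t p / ((∏ i, t i ^ b i) * (∏ i, (1 - t i) ^ c i) *
      ∏ i, ∏ j, if i < j then (t i - t j) ^ a i j else 1) =
      gzf4 p (b 0) (b 1) (b 2) (b 3) (c 0) (c 1) (c 2) (c 3) (a 0 1) (a 0 2) (a 0 3) (a 1 2) (a 1 3) (a 2 3) t := by
  have h00 : ¬ ((0 : Fin 4) < 0) := by decide
  have h01 : ((0 : Fin 4) < 1) := by decide
  have h02 : ((0 : Fin 4) < 2) := by decide
  have h03 : ((0 : Fin 4) < 3) := by decide
  have h10 : ¬ ((1 : Fin 4) < 0) := by decide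
  have h11 : ¬ ((1 : Fin 4) < 1) := by decide
  have h12 : ((1 : Fin 4) < 2) := by decide
  have h13 : ((1 : Fin 4) < 3) := by decide
  have h20 : ¬ ((2 : Fin 4) < 0) := by decide
  have h21 : ¬ ((2 : Fin 4) < 1) := by decide
  have h22 : ¬ ((2 : Fin 4) < 2) := by decide
  have h23 : ((2 : Fin 4) < 3) := by decide
  have h30 : ¬ ((3 : Fin 4) < 0) := by decide
  have h31 : ¬ ((3 : Fin 4) < 1) := by decide
  have h32 : ¬ ((3 : Fin 4) < 2) := by decide
  have h33 : ¬ ((3 : Fin 4) < 3) := by decide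
  rw [gzf4]
  congr 1
  simp only [Fin.prod_univ_four, if_neg h00, if_pos h01, if_pos h02, if_pos h03, if_neg h10, if_neg h11, if_pos h12, if_pos h13, if_neg h20, if_neg h21, if_neg h22, if_pos h23, if_neg h30, if_neg h31, if_neg h32, if_neg h33]
  ring

/-- **REDUCED dimension-4 data**: poles only on the nine non-adjacent chords
`P/(t₀^{β₀} t₁^{β₁} t₂^{β₂} (1-t₁)^{γ₁} (1-t₂)^{γ₂} (1-t₃)^{γ₃} (t₀-t₂)^{α₀₂} (t₀-t₃)^{α₀₃} (t₁-t₃)^{α₁₃})` on `Δ₄`. -/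
def IsReducedFour (r : KZ.IntegralRep 4) : Prop :=
  r.domain = simplex 4 ∧ ∃ (p : MvPolynomial (Fin 4) ℚ) (β₀ β₁ β₂ γ₁ γ₂ γ₃ α₀₂ α₀₃ α₁₃ : ℕ),
    EqOn r.integrand (fun t => MvPolynomial.aeval t p /
      (t 0 ^ β₀ * t 1 ^ β₁ * t 2 ^ β₂ * (1 - t 1) ^ γ₁ * (1 - t 2) ^ γ₂ * (1 - t 3) ^ γ₃ * (t 0 - t 2) ^ α₀₂ * (t 0 - t 3) ^ α₀₃ *
        (t 1 - t 3) ^ α₁₃)) r.domain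

/-- **ANALYTIC WLOG IN DIMENSION 4** (unfolded form). -/
theorem isReduced_of_isGZ_four (r : KZ.IntegralRep 4) (hd : r.domain = KZ.openOrderedSimplex 4)
    (p : MvPolynomial (Fin 4) ℚ) (a : Fin 4 → Fin 4 → ℕ) (b c : Fin 4 → ℕ)
    (hi : EqOn r.integrand (fun t => MvPolynomial.aeval t p / ((∏ i, t i ^ b i) * (∏ i, (1 - t i) ^ c i) *
      ∏ i, ∏ j, if i < j then (t i - t j) ^ a i j else 1)) r.domain) :
    ∃ (p' : MvPolynomial (Fin 4) ℚ) (β₀ β₁ β₂ γ₁ γ₂ γ₃ α₀₂ α₀₃ α₁₃ : ℕ), EqOn r.integrand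
      (fun t => MvPolynomial.aeval t p' /
        (t 0 ^ β₀ * t 1 ^ β₁ * t 2 ^ β₂ * (1 - t 1) ^ γ₁ * (1 - t 2) ^ γ₂ * (1 - t 3) ^ γ₃ * (t 0 - t 2) ^ α₀₂ * (t 0 - t 3) ^ α₀₃ *
          (t 1 - t 3) ^ α₁₃)) r.domain := by
  have hi4 : EqOn r.integrand (gzf4 p (b 0) (b 1) (b 2) (b 3) (c 0) (c 1) (c 2) (c 3) (a 0 1) (a 0 2) (a 0 3) (a 1 2) (a 1 3) (a 2 3))
      (KZ.openOrderedSimplex 4) := by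
    intro t ht
    rw [hi (by rw [hd]; exact ht)]
    exact gzForm_four p a b c t
  have hint : IntegrableOn (gzf4 p (b 0) (b 1) (b 2) (b 3) (c 0) (c 1) (c 2) (c 3) (a 0 1) (a 0 2) (a 0 3) (a 1 2) (a 1 3) (a 2 3))
      (KZ.openOrderedSimplex 4) :=
    (hd ▸ r.integrableOn).congr_fun hi4 (measurableSet_simplex 4)
  obtain ⟨p', hp'⟩ := faces4_cancel p (b 0) (b 1) (b 2) (b 3) (c 0) (c 1) (c 2) (c 3) (a 0 1) (a 0 2) (a 0 3) (a 1 2) (a 1 3) (a 2 3) hint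
  refine ⟨p', b 0, b 1, b 2, c 1, c 2, c 3, a 0 2, a 0 3, a 1 3, fun t ht => ?_⟩
  have ht' : t ∈ KZ.openOrderedSimplex 4 := by rw [← hd]; exact ht
  rw [hi4 ht', hp' ht']

/-- **(A₄) stub S1 `wlog_four`**: a genus-zero datum of dimension 4 is a reduced one. -/
theorem wlog_four : ∀ r : KZ.IntegralRep 4, IsGZ 4 r → IsReducedFour r := by
  rintro r ⟨hd, p, a, b, c, hi⟩
  exact ⟨hd, isReduced_of_isGZ_four r hd p a b c hi⟩

end Summit.KontsevichZagierPeriods.KontsevichZagierPeriods.Cruxes.GZNormalFormWThree.GZLadder.WlogFour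

/-! ## §W8 THE (A₄) FRAME: `PolarReduction 4 ⟸ MATCH₄ ∧ LAYER₄` with S1 (`wlog_four`) discharged — the dimension-4 copy of
`RungThree.rung_three` (`three_wlog ∘ three_reduce ∘ three_layer`). -/

namespace Summit.KontsevichZagierPeriods.KontsevichZagierPeriods.Cruxes.GZNormalFormWThree.GZLadder.WlogFour

open Summit.KontsevichZagierPeriods.KontsevichZagierPeriods.Cruxes.GZNormalFormWThree.GZLadder.RungFour

/-- **single gap-class data of dimension 4** (the analogue of `IsLayerThree`): on `Δ₄`, the integrand is ONE scaled monomial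
`q · g₀^κ₀ g₁^κ₁ g₂^κ₂ g₃^κ₃ g₄^κ₄ / (t₀^β₀ t₁^β₁ t₂^β₂ (1-t₁)^γ₁ (1-t₂)^γ₂ (1-t₃)^γ₃ (t₀-t₂)^α₀₂ (t₀-t₃)^α₀₃ (t₁-t₃)^α₁₃)` in the five GAPS
`g₀ = 1-t₀, g₁ = t₀-t₁, g₂ = t₁-t₂, g₃ = t₂-t₃, g₄ = t₃` (numerator) and the nine non-adjacent chords (denominator); integrability
(= admissibility of the class) is carried by the `IntegralRep`. -/
def IsLayerFour (s : KZ.IntegralRep 4) : Prop :=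
  s.domain = simplex 4 ∧ ∃ (q : ℚ) (κ₀ κ₁ κ₂ κ₃ κ₄ β₀ β₁ β₂ γ₁ γ₂ γ₃ α₀₂ α₀₃ α₁₃ : ℕ),
    EqOn s.integrand (fun t => (q : ℝ) * ((1 - t 0) ^ κ₀ * (t 0 - t 1) ^ κ₁ * (t 1 - t 2) ^ κ₂ * (t 2 - t 3) ^ κ₃ * t 3 ^ κ₄) /
      (t 0 ^ β₀ * t 1 ^ β₁ * t 2 ^ β₂ * (1 - t 1) ^ γ₁ * (1 - t 2) ^ γ₂ * (1 - t 3) ^ γ₃ * (t 0 - t 2) ^ α₀₂ * (t 0 - t 3) ^ α₀₃ *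
        (t 1 - t 3) ^ α₁₃)) s.domain

/-- the layer of dimension 4, as formal generators -/
def layerFour : Set KZ.FormalRep := {x | ∃ s : KZ.IntegralRep 4, IsLayerFour s ∧ x = KZ.of s}

/-- **(A₄) from its three stubs** (shape of `RungThree.rung_three`): analytic wlog (S1), MATCH₄ (reduced data are congruent into
single admissible gap classes and lower genus-zero data: partial fractions + integrable grouping, S5/S6), LAYER₄ (every admissible
gap class is congruent into convergent cellular integrals and lower data: order lowering, multiplier–Stokes over `nl4_i`, S2–S4). -/
theorem polar_four
    (h₃ : ∀ r : KZ.IntegralRep 4, IsGZ 4 r → IsReducedFour r)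
    (h₄ : ∀ r : KZ.IntegralRep 4, IsReducedFour r → CongInto (layerFour ∪ gzLT 4) (KZ.of r))
    (h₅ : ∀ s : KZ.IntegralRep 4, IsLayerFour s → CongInto (cellGens 4 ∪ gzLT 4) (KZ.of s)) :
    PolarReduction 4 := by
  intro r hr
  obtain ⟨m, hm, hrel⟩ := h₄ r (h₃ r hr)
  refine congInto_of_sub_mem hrel (congInto_of_mem_closure (fun x hx => ?_) hm)
  rcases hx with ⟨s, hs, rfl⟩ | hx
  · exact h₅ s hs
  · exact congInto_self (Or.inr hx)

/-- **(A₄) ⟸ MATCH₄ ∧ LAYER₄** — S1 discharged by `wlog_four`. -/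
theorem polarReduction_four_of
    (h₄ : ∀ r : KZ.IntegralRep 4, IsReducedFour r → CongInto (layerFour ∪ gzLT 4) (KZ.of r))
    (h₅ : ∀ s : KZ.IntegralRep 4, IsLayerFour s → CongInto (cellGens 4 ∪ gzLT 4) (KZ.of s)) :
    PolarReduction 4 :=
  polar_four wlog_four h₄ h₅

/-- a layer datum is in particular a reduced datum (so MATCH₄ is the identity on the layer) -/
theorem isReducedFour_of_isLayerFour {s : KZ.IntegralRep 4} (hs : IsLayerFour s) : IsReducedFour s := by
  obtain ⟨hd, q, κ₀, κ₁, κ₂, κ₃, κ₄, β₀, β₁, β₂, γ₁, γ₂, γ₃, α₀₂, α₀₃, α₁₃, hi⟩ := hs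
  refine ⟨hd, MvPolynomial.C q * ((MvPolynomial.C 1 - MvPolynomial.X 0) ^ κ₀ * (MvPolynomial.X 0 - MvPolynomial.X 1) ^ κ₁ *
    (MvPolynomial.X 1 - MvPolynomial.X 2) ^ κ₂ * (MvPolynomial.X 2 - MvPolynomial.X 3) ^ κ₃ * MvPolynomial.X 3 ^ κ₄),
    β₀, β₁, β₂, γ₁, γ₂, γ₃, α₀₂, α₀₃, α₁₃, fun t ht => ?_⟩
  rw [hi ht]
  simp only [map_mul, map_pow, map_sub, MvPolynomial.aeval_C, MvPolynomial.aeval_X, map_one, eq_ratCast]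

end Summit.KontsevichZagierPeriods.KontsevichZagierPeriods.Cruxes.GZNormalFormWThree.GZLadder.WlogFour

/-! ## §M  MATCH₄ ⟸ N₄ ∧ E₄ ∧ S₄ (decomp-kz lens-1 g13, RUNG4_sec22 §23): the dimension-4 copy of the LANDED k = 3 chain
`stub_three_orders` (N) → `gapForm_of_isReducedOrdThree` / `integrand_eq_sum_gapF` (E) → `gapClass_integrableOn` (S) → `sum_pack3` →
`stub_three_match_of_gapClassMatch`, with the per-class step TRIVIAL for the single-monomial layer cut `IsLayerFour` (as `gapClassMatch_layer`). -/

namespace Summit.KontsevichZagierPeriods.KontsevichZagierPeriods.Cruxes.GZNormalFormWThree.GZLadder.MatchFour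

open Summit.KontsevichZagierPeriods.KontsevichZagierPeriods.Cruxes.GZNormalFormWThree.GZLadder.RungFour
open Summit.KontsevichZagierPeriods.KontsevichZagierPeriods.Cruxes.GZNormalFormWThree.GZLadder.WlogFour

/-! ### §M1 The objects: gap classes, admissibility (the nine cluster inequalities), ordered reduced data -/

/-- the gap class `g₀^κ₀ g₁^κ₁ g₂^κ₂ g₃^κ₃ g₄^κ₄ / (t₀^β₀ t₁^β₁ t₂^β₂ (1-t₁)^γ₁ (1-t₂)^γ₂ (1-t₃)^γ₃ (t₀-t₂)^α₀₂ (t₀-t₃)^α₀₃ (t₁-t₃)^α₁₃)` -/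
def gapF4 (κ : Fin 5 →₀ ℕ) (β₀ β₁ β₂ γ₁ γ₂ γ₃ α₀₂ α₀₃ α₁₃ : ℕ) (t : Fin 4 → ℝ) : ℝ :=
  ((1 - t 0) ^ κ 0 * (t 0 - t 1) ^ κ 1 * (t 1 - t 2) ^ κ 2 * (t 2 - t 3) ^ κ 3 * t 3 ^ κ 4) /
    (t 0 ^ β₀ * t 1 ^ β₁ * t 2 ^ β₂ * (1 - t 1) ^ γ₁ * (1 - t 2) ^ γ₂ * (1 - t 3) ^ γ₃ * (t 0 - t 2) ^ α₀₂ * (t 0 - t 3) ^ α₀₃ *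
      (t 1 - t 3) ^ α₁₃)

/-- **ADMISSIBILITY** of a gap class = the CLUSTER CRITERION at the nine proper gap-intervals `G` of length ≥ 2
(`e_G ≤ deg_G κ + |G| - 1`; points `1 > t₀ > t₁ > t₂ > t₃ > 0`, gaps `g₀..g₄`): `G = {1,2,3,4}, {2,3,4}, {3,4}` (clusters at `0`),
`{0,1,2,3}, {0,1,2}, {0,1}` (clusters at `1`), `{1,2}, {1,2,3}, {2,3}` (interior collisions). -/
def Admissible4 (κ : Fin 5 →₀ ℕ) (β₀ β₁ β₂ γ₁ γ₂ γ₃ α₀₂ α₀₃ α₁₃ : ℕ) : Prop :=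
  β₀ + β₁ + β₂ + α₀₂ + α₀₃ + α₁₃ ≤ κ 1 + κ 2 + κ 3 + κ 4 + 3 ∧ β₁ + β₂ + α₁₃ ≤ κ 2 + κ 3 + κ 4 + 2 ∧ β₂ ≤ κ 3 + κ 4 + 1 ∧
  γ₁ + γ₂ + γ₃ + α₀₂ + α₀₃ + α₁₃ ≤ κ 0 + κ 1 + κ 2 + κ 3 + 3 ∧ γ₁ + γ₂ + α₀₂ ≤ κ 0 + κ 1 + κ 2 + 2 ∧ γ₁ ≤ κ 0 + κ 1 + 1 ∧
  α₀₂ ≤ κ 1 + κ 2 + 1 ∧ α₀₂ + α₀₃ + α₁₃ ≤ κ 1 + κ 2 + κ 3 + 2 ∧ α₁₃ ≤ κ 2 + κ 3 + 1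

/-- **REDUCED dimension-4 data WITH THE ORDERS integrability forces** (shape of `IsReducedOrdThree`): the nine cluster conditions on
the numerator `P`, each read in a chart in which the cluster stratum is a coordinate subspace — `P` itself for the clusters at `0`
(`t₃=t₂=t₁=t₀=0`: `|e| + 3`; `t₃=t₂=t₁=0`: `e₁+e₂+e₃+2`; `t₃=t₂=0`: `e₂+e₃+1`), `du4P P = P∘σ₄` for the clusters at `1`, `s03P P = P∘τ₀₁`
(`u = (t₀, t₀-t₃, t₀-t₂, t₀-t₁)`) for `t₀=t₁=t₂` (`u₂=u₃=0`) and `t₀=t₁=t₂=t₃` (`u₁=u₂=u₃=0`), `s13P P = P∘τ₁₂` (`u = (t₀,t₁,t₁-t₃,t₁-t₂)`)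
for `t₁=t₂=t₃` (`u₂=u₃=0`). -/
def IsReducedOrdFour (r : KZ.IntegralRep 4) : Prop :=
  r.domain = simplex 4 ∧ ∃ (p : MvPolynomial (Fin 4) ℚ) (β₀ β₁ β₂ γ₁ γ₂ γ₃ α₀₂ α₀₃ α₁₃ : ℕ),
    (∀ e ∈ p.support, β₀ + β₁ + β₂ + α₀₂ + α₀₃ + α₁₃ ≤ e 0 + e 1 + e 2 + e 3 + 3) ∧
    (∀ e ∈ p.support, β₁ + β₂ + α₁₃ ≤ e 1 + e 2 + e 3 + 2) ∧
    (∀ e ∈ p.support, β₂ ≤ e 2 + e 3 + 1) ∧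
    (∀ e ∈ (du4P p).support, γ₁ + γ₂ + γ₃ + α₀₂ + α₀₃ + α₁₃ ≤ e 0 + e 1 + e 2 + e 3 + 3) ∧
    (∀ e ∈ (du4P p).support, γ₁ + γ₂ + α₀₂ ≤ e 1 + e 2 + e 3 + 2) ∧
    (∀ e ∈ (du4P p).support, γ₁ ≤ e 2 + e 3 + 1) ∧
    (∀ e ∈ (s03P p).support, α₀₂ ≤ e 2 + e 3 + 1) ∧
    (∀ e ∈ (s03P p).support, α₀₂ + α₀₃ + α₁₃ ≤ e 1 + e 2 + e 3 + 2) ∧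
    (∀ e ∈ (s13P p).support, α₁₃ ≤ e 2 + e 3 + 1) ∧
    EqOn r.integrand (fun t => MvPolynomial.aeval t p /
      (t 0 ^ β₀ * t 1 ^ β₁ * t 2 ^ β₂ * (1 - t 1) ^ γ₁ * (1 - t 2) ^ γ₂ * (1 - t 3) ^ γ₃ * (t 0 - t 2) ^ α₀₂ * (t 0 - t 3) ^ α₀₃ *
        (t 1 - t 3) ^ α₁₃)) r.domain

/-- an ordered reduced datum is a reduced datum -/
theorem isReducedFour_of_isReducedOrdFour {r : KZ.IntegralRep 4} (h : IsReducedOrdFour r) : IsReducedFour r := by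
  obtain ⟨hd, p, β₀, β₁, β₂, γ₁, γ₂, γ₃, α₀₂, α₀₃, α₁₃, -, -, -, -, -, -, -, -, -, hi⟩ := h
  exact ⟨hd, p, β₀, β₁, β₂, γ₁, γ₂, γ₃, α₀₂, α₀₃, α₁₃, hi⟩

/-! ### §M2 The three stubs of MATCH₄ -/

/-- **N₄ (orders; analysis)** — the nine cluster pole tests: an integrable reduced datum is an ordered one
(k = 3 template: `stub_three_orders`, WordOrdersThreeP1–P2). -/
def OrdersFour : Prop := ∀ r : KZ.IntegralRep 4, IsReducedFour r → IsReducedOrdFour r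

/-- **E₄ (gap form; algebra)** — an ordered reduced integrand is, on `Δ₄`, a finite ℚ-combination of ADMISSIBLE gap classes
(k = 3 template: `gapForm_of_isReducedOrdThree` / `integrand_eq_sum_gapF`, MatchPrelude P1–P5; g13: the homogeneous gap expansion
`GapExpand.gapExpand` gives the expansion, and in the homogeneous basis `ord_G = min deg_G` (RUNG4_sec22 §23(4)) gives admissibility). -/
def GapFormFour : Prop := ∀ r : KZ.IntegralRep 4, IsReducedOrdFour r →
  ∃ (β₀ β₁ β₂ γ₁ γ₂ γ₃ α₀₂ α₀₃ α₁₃ : ℕ) (H : MvPolynomial (Fin 5) ℚ),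
    (∀ κ ∈ H.support, Admissible4 κ β₀ β₁ β₂ γ₁ γ₂ γ₃ α₀₂ α₀₃ α₁₃) ∧ r.domain = simplex 4 ∧
    EqOn r.integrand (fun t => ∑ κ ∈ H.support, ((MvPolynomial.coeff κ H : ℚ) : ℝ) * gapF4 κ β₀ β₁ β₂ γ₁ γ₂ γ₃ α₀₂ α₀₃ α₁₃ t)
      r.domain

/-- **S₄ (sufficiency; analysis)** — an admissible gap class is integrable on `Δ₄` (k = 3 template: `gapClass_integrableOn`; g13 proof
plan: largest-gap sectors + Gale–Hall loads on the two sides + weighted AM–GM domination by a Dirichlet monomial). -/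
def GapClassIntegrableFour : Prop := ∀ (κ : Fin 5 →₀ ℕ) (β₀ β₁ β₂ γ₁ γ₂ γ₃ α₀₂ α₀₃ α₁₃ : ℕ),
  Admissible4 κ β₀ β₁ β₂ γ₁ γ₂ γ₃ α₀₂ α₀₃ α₁₃ → IntegrableOn (gapF4 κ β₀ β₁ β₂ γ₁ γ₂ γ₃ α₀₂ α₀₃ α₁₃) (KZ.openOrderedSimplex 4)

/-! ### §M3 Rule 1b iterated on `Δ₄` (port of `WordLayer.sum_pack3`) -/

/-- `[Δ₄, f]` for a semialgebraic integrable `f` -/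
def repFour (f : (Fin 4 → ℝ) → ℝ) (hsa : IsSemialgebraicFunOn ℚ (KZ.openOrderedSimplex 4) f)
    (hint : IntegrableOn f (KZ.openOrderedSimplex 4)) : KZ.IntegralRep 4 where
  domain := KZ.openOrderedSimplex 4
  integrand := f
  isSemialgebraic_domain := KZ.isSemialgebraic_openOrderedSimplex 4
  isSemialgebraicFunOn_integrand := hsa
  integrableOn := hint

/-- a representation whose integrand vanishes on its domain is a relation (rule 1b: `f = f + f`) -/
private theorem of_mem_relations_of_integrand_zero4 {n : ℕ} (z : KZ.IntegralRep n)
    (hz : ∀ x ∈ z.domain, z.integrand x = 0) : KZ.of z ∈ KZ.relations := by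
  have h3 : KZ.of z - KZ.of z - KZ.of z ∈ KZ.relations :=
    KZ.integrandAddRel_subset_relations ⟨n, z, z, z, rfl, rfl, fun x hx => by simp [hz x hx], rfl⟩
  rw [show KZ.of z - KZ.of z - KZ.of z = -KZ.of z by abel] at h3
  exact neg_mem_iff.mp h3

end Summit.KontsevichZagierPeriods.KontsevichZagierPeriods.Cruxes.GZNormalFormWThree.GZLadder.MatchFour
end
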